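import Summits.KontsevichZagierPeriods.KontsevichZagierPeriods.Theses.HurwitzMicroSectors
import Literature.NumberTheory.Transcendental.KZMellinFibres
import Literature.NumberTheory.Transcendental.KZLogCalculusProofs
import Literature.NumberTheory.Transcendental.KZRelationsLE
import Literature.NumberTheory.Transcendental.BoxIntegralHurwitzWeightTwo
import Literature.NumberTheory.Transcendental.BoxCoordinatePowerMap

/-!
# Sketch — crux `ReductionTwoSix` (stmt-KontsevichZagierPeriods-3871), ideator 3, round 1

First lemmas of the three idea cards, stated over existing declarations, and the two
composition theorems showing that each line CONCLUDES the crux by name.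

* Card `constant-dilation-frozen-box`: `MonomialDilation` and its derivation from the route's
  engine `DilationMove` (item 3872) — the polynomial part of the reduction is ONE change of
  variables per monomial, on the frozen open box, no Newton–Leibniz.
* Card `numerator-presentation`: `gens6`, `nfNum`, `PolynomialNormalFormSix` (pure algebra in
  `ℚ[X]`), `NumeratorCongruence` (the analytic half), `SectorRepExists`, and
  `reductionTwoSix_of_presentation : … → ReductionTwoSix`.
* Card `parity-descent-level-three`: `ParityDescent`, `LevelThreeNormalForm`, `NormalFormAdd`, and
  `reductionTwoSix_of_parityDescent : … → ReductionTwoSix`.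
-/

set_option linter.dupNamespace false

namespace Summit.KontsevichZagierPeriods.KontsevichZagierPeriods.Cruxes.ReductionTwoSix.Sketch

open Set MeasureTheory Polynomial
open Literature.NumberTheory.Transcendental
open Summit.KontsevichZagierPeriods.KontsevichZagierPeriods.Theses.HurwitzMicroSectors

noncomputable section

/-- The open unit box of `ℝ²` (literal shape used by the route items). -/
abbrev box : Set (Fin 2 → ℝ) := {x | ∀ i, x i ∈ Set.Ioo (0:ℝ) 1}

/-! ### Card A: the polynomial part is a level-one distribution relation -/

/-- **MonomialDilation** (card `constant-dilation-frozen-box`, first lemma): on the open box,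
`[q·(xy)ᵏ] ~ [q/(k+1)²]` — ONE change of variables `xᵢ ↦ xᵢ^(k+1)` applied to the CONSTANT
integrand `q/(k+1)²` (Jacobian `(k+1)² (xy)ᵏ`). -/
def MonomialDilation : Prop :=
  ∀ (k : ℕ) (q : ℚ) (r r' : KZ.IntegralRep 2), r.domain = box → r'.domain = box →
    EqOn r.integrand (fun x => (q : ℝ) * (x 0 * x 1) ^ k) r.domain →
    EqOn r'.integrand (fun _ => (q : ℝ) / ((k : ℝ) + 1) ^ 2) r'.domain →
    KZ.Equivalent r r'

/-- `MonomialDilation` is the instance `n = 2`, `m = k + 1`, constant target integrand, of the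
route's engine `DilationMove` (item stmt-KontsevichZagierPeriods-3872). -/
theorem monomialDilation_of_dilationMove (h : DilationMove) : MonomialDilation := by
  intro k q r r' hr hr' hf hf'
  have hm : 1 ≤ k + 1 := Nat.succ_le_succ (Nat.zero_le k)
  have hmem : KZ.of r - KZ.of r' ∈ KZ.changeOfVariablesRel := by
    refine h 2 (k + 1) hm r r' hr hr' ?_
    intro x hx
    have hxb : x ∈ box := by rw [hr] at hx; exact hx
    have hx' : (fun i => x i ^ (k + 1)) ∈ r'.domain := by
      rw [hr']
      intro i
      exact ⟨pow_pos (hxb i).1 _, pow_lt_one₀ (hxb i).1.le (hxb i).2 (Nat.succ_ne_zero k)⟩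
    rw [hf hx, hf' hx']
    simp only [Fin.prod_univ_two, Nat.add_sub_cancel, Nat.cast_add, Nat.cast_one]
    have hk : ((k : ℝ) + 1) ≠ 0 := by positivity
    field_simp
    ring
  exact KZ.changeOfVariablesRel_subset_relations hmem

/-! ### Card B: the numerator presentation `Ψ : ℚ[X] → FormalRep / relations` -/

/-- Dilation `m = 2` read on numerators: `Ψ(4·X·Q(X²)) = Ψ((1+X³)·Q)`
(`4t·Q(t²)/(1−t⁶)` is the pull-back of `Q(s)/(1−s³)` along `xᵢ ↦ xᵢ²`). -/
def gen2 : Set ℚ[X] := {g | ∃ Q : ℚ[X], g = 4 * (X * Q.comp (X ^ 2)) - (1 + X ^ 3) * Q}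

/-- Dilation `m = 3` read on numerators: `Ψ(9·X²·Q(X³)) = Ψ((1+X²+X⁴)·Q)`. -/
def gen3 : Set ℚ[X] := {g | ∃ Q : ℚ[X], g = 9 * (X ^ 2 * Q.comp (X ^ 3)) - (1 + X ^ 2 + X ^ 4) * Q}

/-- Dilation `m = k+1` on the constant `q/(k+1)²`, read on numerators:
`Ψ(q(Xᵏ − Xᵏ⁺⁶)) = Ψ(q/(k+1)² · (1 − X⁶))` (`tᵏ = (tᵏ − tᵏ⁺⁶)/(1−t⁶)`, `1 = (1−t⁶)/(1−t⁶)`). -/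
def genMono : Set ℚ[X] :=
  {g | ∃ (q : ℚ) (k : ℕ), g = C q * (X ^ k - X ^ (k + 6)) - C (q / ((k : ℚ) + 1) ^ 2) * (1 - X ^ 6)}

/-- The three ℚ-homogeneous generator families of `ker Ψ`. -/
def gens6 : Set ℚ[X] := gen2 ∪ gen3 ∪ genMono

/-- The numerator of the normal form `a + b/(1−t) + c/(1+t+t²) = nfNum a b c (t) / (1 − t⁶)`. -/
def nfNum (a b c : ℚ) : ℚ[X] :=
  C a * (1 - X ^ 6) + C b * (1 + X + X ^ 2 + X ^ 3 + X ^ 4 + X ^ 5) + C c * (1 - X + X ^ 3 - X ^ 4)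

/-- **PolynomialNormalFormSix** (card `numerator-presentation`, the ALGEBRAIC half; pure
commutative algebra in `ℚ[X]`, no analysis): every numerator is a normal-form numerator modulo
the subgroup generated by `gens6`. -/
def PolynomialNormalFormSix : Prop :=
  ∀ P : ℚ[X], ∃ a b c : ℚ, P - nfNum a b c ∈ AddSubgroup.closure gens6

/-- **NumeratorCongruence** (card `numerator-presentation`, the ANALYTIC half): two box
representations of the sector whose numerators are congruent modulo `gens6` are KZ-equivalent
(rule 1b gives additivity of `Ψ`; each generator is ONE change of variables, `DilationMove`). -/
def NumeratorCongruence : Prop :=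
  ∀ (P₁ P₂ : ℚ[X]) (r₁ r₂ : KZ.IntegralRep 2), r₁.domain = box → r₂.domain = box →
    EqOn r₁.integrand (fun x => aeval (x 0 * x 1) P₁ / (1 - (x 0 * x 1) ^ 6)) r₁.domain →
    EqOn r₂.integrand (fun x => aeval (x 0 * x 1) P₂ / (1 - (x 0 * x 1) ^ 6)) r₂.domain →
    P₁ - P₂ ∈ AddSubgroup.closure gens6 → KZ.Equivalent r₁ r₂

/-- Existence of the sector representation with a given numerator (semialgebraic rational
integrand, integrable: dominated by `C/(1 − xy)`). -/
def SectorRepExists : Prop :=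
  ∀ P : ℚ[X], ∃ r : KZ.IntegralRep 2, r.domain = box ∧
    EqOn r.integrand (fun x => aeval (x 0 * x 1) P / (1 - (x 0 * x 1) ^ 6)) r.domain

/-- On the open box `t = x₀x₁ ∈ (0,1)`. -/
theorem mul_mem_Ioo {x : Fin 2 → ℝ} (hx : x ∈ box) : x 0 * x 1 ∈ Set.Ioo (0:ℝ) 1 :=
  ⟨mul_pos (hx 0).1 (hx 1).1,
    mul_lt_one_of_nonneg_of_lt_one_left (hx 0).1.le (hx 0).2 (hx 1).2.le⟩

/-- The normal form IS a sector function: `nfNum a b c (t)/(1−t⁶) = a + b/(1−t) + c/(1+t+t²)`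
for `t ∈ (0,1)` — a function identity, no move. -/
theorem nfNum_div (a b c : ℚ) {t : ℝ} (ht : t ∈ Set.Ioo (0:ℝ) 1) :
    aeval t (nfNum a b c) / (1 - t ^ 6) = (a : ℝ) + b / (1 - t) + c / (1 + t + t ^ 2) := by
  have h1 : (1 : ℝ) - t ≠ 0 := by linarith [ht.2]
  have h2 : (1 : ℝ) + t + t ^ 2 ≠ 0 := by nlinarith [ht.1]
  have h6 : (1 : ℝ) - t ^ 6 ≠ 0 := by
    have : t ^ 6 < 1 := pow_lt_one₀ ht.1.le ht.2 (by norm_num)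
    linarith
  simp only [nfNum, map_add, map_sub, map_mul, map_pow, aeval_C, aeval_X, map_one,
    eq_ratCast]
  rw [div_eq_iff h6]
  field_simp
  ring

/-- **Composition for card B**: the numerator presentation decides the crux BY NAME. -/
theorem reductionTwoSix_of_presentation (hA : PolynomialNormalFormSix) (hC : NumeratorCongruence)
    (hE : SectorRepExists) : ReductionTwoSix := by
  intro r P hr hf
  obtain ⟨a, b, c, hmem⟩ := hA P
  obtain ⟨r', hr', hf'⟩ := hE (nfNum a b c)
  refine ⟨a, b, c, r', hr', ?_, hC P (nfNum a b c) r r' hr hr' hf hf' hmem⟩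
  intro x hx
  have hxb : x ∈ box := by rw [hr'] at hx; exact hx
  rw [hf' hx]
  exact nfNum_div a b c (mul_mem_Ioo hxb)

/-! ### Card C: parity descent `level 6 → level 3 ⊕ level 3` -/

/-- The normal-form integrand (literal shape of the crux). -/
def NF (a b c : ℚ) (x : Fin 2 → ℝ) : ℝ :=
  (a : ℝ) + b / (1 - x 0 * x 1) + c / (1 + x 0 * x 1 + (x 0 * x 1) ^ 2)

/-- **ParitySplit** (pure algebra): every numerator is `E(X²) + X·R(X²)`. -/
def ParitySplit : Prop := ∀ P : ℚ[X], ∃ E R : ℚ[X], P = E.comp (X ^ 2) + X * R.comp (X ^ 2)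

/-- **ParityDescent** (card `parity-descent-level-three`, first lemma): for a numerator written by parity,
`P = E(t²) + t·R(t²)`, one has `[P/(1−t⁶)] = [E(t²)(1+t³)/(1−t⁶)] + [4t·B(t²)/(1−t⁶)]` with
`B = (R − X·E)/4` (rule 1b, a function identity), the first summand IS the level-3 representation
`[E(t²)/(1−t³)]`, and the second is the pull-back of the LEVEL-3 representation `[B(s)/(1−s³)]` along ONE
dilation `xᵢ ↦ xᵢ²`. Net: `[r] − [s] − [u] ∈ relations` with `s`, `u` of level 3. -/
def ParityDescent : Prop :=
  ∀ (E R : ℚ[X]) (r : KZ.IntegralRep 2), r.domain = box →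
    EqOn r.integrand
      (fun x => aeval (x 0 * x 1) (E.comp (X ^ 2) + X * R.comp (X ^ 2)) / (1 - (x 0 * x 1) ^ 6)) r.domain →
    ∃ (s u : KZ.IntegralRep 2), s.domain = box ∧ u.domain = box ∧
      EqOn s.integrand (fun x => aeval (x 0 * x 1) (E.comp (X ^ 2)) / (1 - (x 0 * x 1) ^ 3)) s.domain ∧
      EqOn u.integrand
        (fun x => aeval (x 0 * x 1) (C (1 / 4 : ℚ) * (R - X * E)) / (1 - (x 0 * x 1) ^ 3)) u.domain ∧
      KZ.of r - KZ.of s - KZ.of u ∈ KZ.relations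

/-- **LevelThreeNormalForm**: the level-3 sector `A(t)/(1−t³)` has the SAME normal forms, with ONE
distribution relation (`9t²/(1−t³) ~ 1/(1−t)`, dilation `m = 3` on `1/(1−s)`) and the monomial
dilations; `{1/(1−t), 1/(1+t+t²)} = {(1+t+t²)/(1−t³), (1−t)/(1−t³)}` is a level-3 basis. -/
def LevelThreeNormalForm : Prop :=
  ∀ (A : ℚ[X]) (s : KZ.IntegralRep 2), s.domain = box →
    EqOn s.integrand (fun x => aeval (x 0 * x 1) A / (1 - (x 0 * x 1) ^ 3)) s.domain →
    ∃ (a b c : ℚ) (n : KZ.IntegralRep 2), n.domain = box ∧ EqOn n.integrand (NF a b c) n.domain ∧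
      KZ.Equivalent s n

/-- **NormalFormAdd**: the sum of two normal forms is a normal form (one rule-1b move). -/
def NormalFormAdd : Prop :=
  ∀ (a b c a' b' c' : ℚ) (n n' : KZ.IntegralRep 2), n.domain = box → n'.domain = box →
    EqOn n.integrand (NF a b c) n.domain → EqOn n'.integrand (NF a' b' c') n'.domain →
    ∃ m : KZ.IntegralRep 2, m.domain = box ∧ EqOn m.integrand (NF (a + a') (b + b') (c + c')) m.domain ∧
      KZ.of m - KZ.of n - KZ.of n' ∈ KZ.relations

/-- **Composition for card C**: parity split + parity descent + level-3 normal form (+ additivity of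
normal forms) decide the crux BY NAME. -/
theorem reductionTwoSix_of_parityDescent (h0 : ParitySplit) (h1 : ParityDescent)
    (h2 : LevelThreeNormalForm) (h3 : NormalFormAdd) : ReductionTwoSix := by
  intro r P hr hf
  obtain ⟨E, R, hP⟩ := h0 P
  rw [hP] at hf
  obtain ⟨s, u, hs, hu, hsA, huB, hrel⟩ := h1 E R r hr hf
  obtain ⟨a, b, c, n, hn, hnf, hsn⟩ := h2 _ s hs hsA
  obtain ⟨a', b', c', n', hn', hnf', hun'⟩ := h2 _ u hu huB
  obtain ⟨m, hm, hmf, hmrel⟩ := h3 a b c a' b' c' n n' hn hn' hnf hnf'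
  refine ⟨a + a', b + b', c + c', m, hm, ?_, ?_⟩
  · intro x hx
    rw [hmf hx]
    simp only [NF, Rat.cast_add]
  · have e : KZ.of r - KZ.of m =
        (KZ.of r - KZ.of s - KZ.of u) + (KZ.of s - KZ.of n) + (KZ.of u - KZ.of n') -
          (KZ.of m - KZ.of n - KZ.of n') := by abel
    show KZ.of r - KZ.of m ∈ KZ.relations
    rw [e]
    exact KZ.relations.sub_mem (KZ.relations.add_mem (KZ.relations.add_mem hrel hsn) hun') hmrel

/-! ### The generator families ARE single moves (card B, analytic half, from the engine) -/

/-- Points of the box have coordinatewise powers in the box. -/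
theorem pow_mem_box {x : Fin 2 → ℝ} (hx : x ∈ box) {m : ℕ} (hm : m ≠ 0) :
    (fun i => x i ^ m) ∈ box :=
  fun i => ⟨pow_pos (hx i).1 _, pow_lt_one₀ (hx i).1.le (hx i).2 hm⟩

/-- **`gen2` is ONE change of variables**: `[4t·Q(t²)/(1−t⁶)] ~ [(1+t³)Q(t)/(1−t⁶)]`
(`= [Q(s)/(1−s³)]` as a function), the dilation `xᵢ ↦ xᵢ²` of `DilationMove`. -/
theorem gen2_move (h : DilationMove) (Q : ℚ[X]) (r r' : KZ.IntegralRep 2)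
    (hr : r.domain = box) (hr' : r'.domain = box)
    (hf : EqOn r.integrand
      (fun x => aeval (x 0 * x 1) (4 * (X * Q.comp (X ^ 2))) / (1 - (x 0 * x 1) ^ 6)) r.domain)
    (hf' : EqOn r'.integrand
      (fun x => aeval (x 0 * x 1) ((1 + X ^ 3) * Q) / (1 - (x 0 * x 1) ^ 6)) r'.domain) :
    KZ.Equivalent r r' := by
  have hmem : KZ.of r - KZ.of r' ∈ KZ.changeOfVariablesRel := by
    refine h 2 2 (by norm_num) r r' hr hr' ?_
    intro x hx
    have hxb : x ∈ box := by rw [hr] at hx; exact hx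
    have hx' : (fun i => x i ^ 2) ∈ r'.domain := by rw [hr']; exact pow_mem_box hxb two_ne_zero
    rw [hf hx, hf' hx']
    have ht := mul_mem_Ioo hxb
    have e : x 0 ^ 2 * x 1 ^ 2 = (x 0 * x 1) ^ 2 := by ring
    simp only [Fin.prod_univ_two, map_mul, map_add, map_pow, map_one, map_ofNat, aeval_X,
      aeval_comp, e]
    have h6 : (1:ℝ) - (x 0 * x 1) ^ 6 ≠ 0 := by
      have : (x 0 * x 1) ^ 6 < 1 := pow_lt_one₀ ht.1.le ht.2 (by norm_num); linarith
    have h6' : (1:ℝ) + (x 0 * x 1) ^ 6 ≠ 0 := by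
      have : 0 ≤ (x 0 * x 1) ^ 6 := pow_nonneg ht.1.le 6; linarith
    have e12 : (1:ℝ) - ((x 0 * x 1) ^ 2) ^ 6 = (1 - (x 0 * x 1) ^ 6) * (1 + (x 0 * x 1) ^ 6) := by
      ring
    rw [e12]
    norm_num
    field_simp
  exact KZ.changeOfVariablesRel_subset_relations hmem

/-- **`gen3` is ONE change of variables**: `[9t²·Q(t³)/(1−t⁶)] ~ [(1+t²+t⁴)Q(t)/(1−t⁶)]`
(`= [Q(s)/(1−s²)]` as a function), the dilation `xᵢ ↦ xᵢ³`. -/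
theorem gen3_move (h : DilationMove) (Q : ℚ[X]) (r r' : KZ.IntegralRep 2)
    (hr : r.domain = box) (hr' : r'.domain = box)
    (hf : EqOn r.integrand
      (fun x => aeval (x 0 * x 1) (9 * (X ^ 2 * Q.comp (X ^ 3))) / (1 - (x 0 * x 1) ^ 6)) r.domain)
    (hf' : EqOn r'.integrand
      (fun x => aeval (x 0 * x 1) ((1 + X ^ 2 + X ^ 4) * Q) / (1 - (x 0 * x 1) ^ 6)) r'.domain) :
    KZ.Equivalent r r' := by
  have hmem : KZ.of r - KZ.of r' ∈ KZ.changeOfVariablesRel := by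
    refine h 2 3 (by norm_num) r r' hr hr' ?_
    intro x hx
    have hxb : x ∈ box := by rw [hr] at hx; exact hx
    have hx' : (fun i => x i ^ 3) ∈ r'.domain := by rw [hr']; exact pow_mem_box hxb three_ne_zero
    rw [hf hx, hf' hx']
    have ht := mul_mem_Ioo hxb
    have e : x 0 ^ 3 * x 1 ^ 3 = (x 0 * x 1) ^ 3 := by ring
    simp only [Fin.prod_univ_two, map_mul, map_add, map_pow, map_one, map_ofNat, aeval_X,
      aeval_comp, e]
    have h6 : (1:ℝ) - (x 0 * x 1) ^ 6 ≠ 0 := by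
      have : (x 0 * x 1) ^ 6 < 1 := pow_lt_one₀ ht.1.le ht.2 (by norm_num); linarith
    have h6' : (1:ℝ) + (x 0 * x 1) ^ 6 + (x 0 * x 1) ^ 12 ≠ 0 := by
      have h₁ : 0 ≤ (x 0 * x 1) ^ 6 := pow_nonneg ht.1.le 6
      have h₂ : 0 ≤ (x 0 * x 1) ^ 12 := pow_nonneg ht.1.le 12
      linarith
    have e18 : (1:ℝ) - ((x 0 * x 1) ^ 3) ^ 6 =
        (1 - (x 0 * x 1) ^ 6) * (1 + (x 0 * x 1) ^ 6 + (x 0 * x 1) ^ 12) := by ring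
    rw [e18]
    norm_num
    field_simp
  exact KZ.changeOfVariablesRel_subset_relations hmem

/-- **`genMono` is ONE change of variables** (card A inside card B):
`[q(tᵏ − tᵏ⁺⁶)/(1−t⁶)] = [q tᵏ] ~ [q/(k+1)²] = [q/(k+1)² · (1−t⁶)/(1−t⁶)]`. -/
theorem genMono_move (h : MonomialDilation) (q : ℚ) (k : ℕ) (r r' : KZ.IntegralRep 2)
    (hr : r.domain = box) (hr' : r'.domain = box)
    (hf : EqOn r.integrand
      (fun x => aeval (x 0 * x 1) (C q * (X ^ k - X ^ (k + 6))) / (1 - (x 0 * x 1) ^ 6)) r.domain)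
    (hf' : EqOn r'.integrand
      (fun x => aeval (x 0 * x 1) (C (q / ((k : ℚ) + 1) ^ 2) * (1 - X ^ 6)) / (1 - (x 0 * x 1) ^ 6))
        r'.domain) :
    KZ.Equivalent r r' := by
  refine h k q r r' hr hr' ?_ ?_
  · intro x hx
    have hxb : x ∈ box := by rw [hr] at hx; exact hx
    have ht := mul_mem_Ioo hxb
    rw [hf hx]
    simp only [map_mul, map_sub, map_pow, aeval_C, aeval_X, eq_ratCast]
    have h6 : (1:ℝ) - (x 0 * x 1) ^ 6 ≠ 0 := by
      have : (x 0 * x 1) ^ 6 < 1 := pow_lt_one₀ ht.1.le ht.2 (by norm_num); linarith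
    rw [div_eq_iff h6]
    ring
  · intro x hx
    have hxb : x ∈ box := by rw [hr'] at hx; exact hx
    have ht := mul_mem_Ioo hxb
    rw [hf' hx]
    simp only [map_mul, map_sub, map_pow, map_one, aeval_C, aeval_X, eq_ratCast]
    have h6 : (1:ℝ) - (x 0 * x 1) ^ 6 ≠ 0 := by
      have : (x 0 * x 1) ^ 6 < 1 := pow_lt_one₀ ht.1.le ht.2 (by norm_num); linarith
    rw [mul_div_assoc, div_self h6, mul_one]
    push_cast
    ring

/-! ### Representation constructors (the two existence hypotheses are provable now) -/

open Literature.ModelTheory.ExponentialFields (IsSemialgebraic)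

/-- The box is `ℚ`-semialgebraic (tree: `KZ.isSemialgebraic_box`). -/
theorem isSemialgebraic_box' : IsSemialgebraic ℚ box := KZ.isSemialgebraic_box 2

/-- `t = X₀X₁` as a bivariate polynomial. -/
def tPoly : MvPolynomial (Fin 2) ℚ := MvPolynomial.X 0 * MvPolynomial.X 1

@[simp] theorem aeval_tPoly (x : Fin 2 → ℝ) : MvPolynomial.aeval x tPoly = x 0 * x 1 := by
  simp [tPoly]

/-- Univariate numerators become bivariate polynomials in `t = X₀X₁`. -/
theorem aeval_aeval_tPoly (x : Fin 2 → ℝ) (P : ℚ[X]) :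
    MvPolynomial.aeval x (Polynomial.aeval tPoly P) = Polynomial.aeval (x 0 * x 1) P := by
  rw [← aeval_tPoly x, ← Polynomial.aeval_algHom_apply]

/-- **The sector representation exists** (`SectorRepExists` holds): `P(t)/(1−t⁶)` is a quotient of
`ℚ`-polynomials with non-vanishing denominator on the box (`KZ.IntegralRep.ofRational`) and is
integrable there (finite sum of `tʳ/(1−t⁶)`, tree: `BoxIntegral.integrableOn_box_pow_div_one_sub_pow`). -/
theorem sectorRepExists_holds : SectorRepExists := by
  intro P
  have hq : ∀ x ∈ box, MvPolynomial.aeval x (1 - tPoly ^ 6) ≠ 0 := by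
    intro x hx
    have ht := mul_mem_Ioo hx
    simp only [map_sub, map_one, map_pow, aeval_tPoly]
    have : (x 0 * x 1) ^ 6 < 1 := pow_lt_one₀ ht.1.le ht.2 (by norm_num)
    linarith
  have hint : IntegrableOn (fun x : Fin 2 → ℝ =>
      MvPolynomial.aeval x (Polynomial.aeval tPoly P) / MvPolynomial.aeval x (1 - tPoly ^ 6)) box := by
    have h := MeasureTheory.integrable_finsetSum (μ := volume.restrict box) (Finset.range (P.natDegree + 1))
      (f := fun i (x : Fin 2 → ℝ) => (P.coeff i : ℝ) * ((x 0 * x 1) ^ i / (1 - (x 0 * x 1) ^ 6)))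
      (fun i _ => (BoxIntegral.integrableOn_box_pow_div_one_sub_pow (m := 6) (by norm_num) i).const_mul _)
    refine (IntegrableOn.congr_fun h (fun x hx => ?_) (BoxIntegral.measurableSet_box 2))
    simp only [map_sub, map_one, map_pow, aeval_tPoly, aeval_aeval_tPoly]
    rw [Polynomial.aeval_eq_sum_range, Finset.sum_div]
    refine Finset.sum_congr rfl fun i _ => ?_
    rw [Algebra.smul_def, eq_ratCast]
    ring
  refine ⟨KZ.IntegralRep.ofRational box (Polynomial.aeval tPoly P) (1 - tPoly ^ 6)
    isSemialgebraic_box' hq hint, rfl, ?_⟩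
  intro x _
  simp [KZ.IntegralRep.ofRational, aeval_aeval_tPoly]

/-- The normal-form representation, as KZ-literal rational data `p/q` with
`q = (1 − t)(1 + t + t²)`. -/
theorem exists_nfRep (a b c : ℚ) :
    ∃ m : KZ.IntegralRep 2, m.domain = box ∧ EqOn m.integrand (NF a b c) m.domain := by
  set q : MvPolynomial (Fin 2) ℚ := (1 - tPoly) * (1 + tPoly + tPoly ^ 2) with hq_def
  set p : MvPolynomial (Fin 2) ℚ :=
    MvPolynomial.C a * ((1 - tPoly) * (1 + tPoly + tPoly ^ 2)) + MvPolynomial.C b * (1 + tPoly + tPoly ^ 2)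
      + MvPolynomial.C c * (1 - tPoly) with hp_def
  have hden : ∀ x ∈ box, (1 - x 0 * x 1) ≠ 0 ∧ (1 + x 0 * x 1 + (x 0 * x 1) ^ 2) ≠ 0 := by
    intro x hx
    have ht := mul_mem_Ioo hx
    exact ⟨by linarith [ht.2], by nlinarith [ht.1]⟩
  have hq : ∀ x ∈ box, MvPolynomial.aeval x q ≠ 0 := by
    intro x hx
    simp only [hq_def, map_mul, map_sub, map_add, map_one, map_pow, aeval_tPoly]
    exact mul_ne_zero (hden x hx).1 (hden x hx).2
  have hfun : ∀ x ∈ box, MvPolynomial.aeval x p / MvPolynomial.aeval x q = NF a b c x := by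
    intro x hx
    obtain ⟨h1, h2⟩ := hden x hx
    have h2' : 1 + x 0 * x 1 + x 0 ^ 2 * x 1 ^ 2 ≠ 0 := by rw [← mul_pow]; exact h2
    simp only [hp_def, hq_def, NF, map_mul, map_sub, map_add, map_one, map_pow, aeval_tPoly,
      MvPolynomial.aeval_C, eq_ratCast]
    rw [div_eq_iff (mul_ne_zero h1 h2)]
    field_simp

  have hint : IntegrableOn (fun x : Fin 2 → ℝ => MvPolynomial.aeval x p / MvPolynomial.aeval x q) box :=
    (BoxIntegral.integrableOn_box_normalForm a b c).congr_fun (fun x hx => (hfun x hx).symm)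
      (BoxIntegral.measurableSet_box 2)
  exact ⟨KZ.IntegralRep.ofRational box p q isSemialgebraic_box' hq hint, rfl, fun x hx => hfun x hx⟩

/-- **`NormalFormAdd` holds**: one integrand-additivity move. -/
theorem normalFormAdd_holds : NormalFormAdd := by
  intro a b c a' b' c' n n' hn hn' hnf hnf'
  obtain ⟨m, hm, hmf⟩ := exists_nfRep (a + a') (b + b') (c + c')
  refine ⟨m, hm, hmf, ?_⟩
  refine KZ.integrandAddRel_subset_relations ⟨2, m, n, n', by rw [hn, hm], by rw [hn', hm], ?_, rfl⟩
  intro x hx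
  have hxn : x ∈ n.domain := by rw [hn]; rw [hm] at hx; exact hx
  have hxn' : x ∈ n'.domain := by rw [hn']; rw [hm] at hx; exact hx
  rw [hmf hx, Pi.add_apply, hnf hxn, hnf' hxn']
  simp only [NF, Rat.cast_add]
  ring

/-- `1 − t⁶ = (1 − t³)(1 + t³)`: a level-3 representation is a level-6 sector representation with
numerator `(1 + X³)·A` — a FUNCTION identity on the box, no move. -/
theorem level3_as_level6 (A : ℚ[X]) {t : ℝ} (ht : t ∈ Set.Ioo (0:ℝ) 1) :
    aeval t ((1 + X ^ 3) * A) / (1 - t ^ 6) = aeval t A / (1 - t ^ 3) := by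
  have h3 : (1:ℝ) - t ^ 3 ≠ 0 := by
    have : t ^ 3 < 1 := pow_lt_one₀ ht.1.le ht.2 (by norm_num); linarith
  have h3' : (1:ℝ) + t ^ 3 ≠ 0 := by
    have : 0 ≤ t ^ 3 := pow_nonneg ht.1.le 3; linarith
  have e6 : (1:ℝ) - t ^ 6 = (1 - t ^ 3) * (1 + t ^ 3) := by ring
  simp only [map_mul, map_add, map_pow, map_one, aeval_X]
  rw [e6, div_eq_div_iff (mul_ne_zero h3 h3') h3]
  ring

/-- **`ParityDescent` holds given the engine**: one `integrandAddRel` instance (the parity identity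
`E(t²) + tR(t²) = (1+t³)E(t²) + 4t·B(t²)`, `B = (R − X E)/4`) plus ONE dilation (`gen2_move` with `Q = B`). -/
theorem parityDescent_of_dilationMove (h : DilationMove) : ParityDescent := by
  intro E R r hr hf
  set B : ℚ[X] := C (1 / 4 : ℚ) * (R - X * E) with hB
  obtain ⟨s, hs, hsf⟩ := sectorRepExists_holds ((1 + X ^ 3) * E.comp (X ^ 2))
  obtain ⟨u', hu', hu'f⟩ := sectorRepExists_holds (4 * (X * B.comp (X ^ 2)))
  obtain ⟨u, hu, huf⟩ := sectorRepExists_holds ((1 + X ^ 3) * B)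
  refine ⟨s, u, hs, hu, ?_, ?_, ?_⟩
  · intro x hx
    have hxb : x ∈ box := by rw [hs] at hx; exact hx
    rw [hsf hx]
    exact level3_as_level6 _ (mul_mem_Ioo hxb)
  · intro x hx
    have hxb : x ∈ box := by rw [hu] at hx; exact hx
    rw [huf hx]
    exact level3_as_level6 _ (mul_mem_Ioo hxb)
  · have h1 : KZ.of r - KZ.of s - KZ.of u' ∈ KZ.relations := by
      refine KZ.integrandAddRel_subset_relations ⟨2, r, s, u', by rw [hs, hr], by rw [hu', hr], ?_, rfl⟩
      intro x hx
      have hxb : x ∈ box := by rw [hr] at hx; exact hx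
      have hxs : x ∈ s.domain := by rw [hs]; exact hxb
      have hxu : x ∈ u'.domain := by rw [hu']; exact hxb
      rw [Pi.add_apply, hf hx, hsf hxs, hu'f hxu]
      have ht := mul_mem_Ioo hxb
      have h6 : (1:ℝ) - (x 0 * x 1) ^ 6 ≠ 0 := by
        have : (x 0 * x 1) ^ 6 < 1 := pow_lt_one₀ ht.1.le ht.2 (by norm_num); linarith
      simp only [hB, map_add, map_mul, map_sub, map_pow, map_one, map_ofNat, aeval_X, aeval_C, aeval_comp,
        eq_ratCast]
      rw [← add_div, div_left_inj' h6]
      push_cast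
      ring
    have h2 : KZ.Equivalent u' u := gen2_move h B u' u hu' hu hu'f huf
    have e : KZ.of r - KZ.of s - KZ.of u = (KZ.of r - KZ.of s - KZ.of u') + (KZ.of u' - KZ.of u) := by
      abel
    rw [e]
    exact KZ.relations.add_mem h1 h2

/-- Card C therefore needs exactly two stubs: the pure-algebra `ParitySplit` and `LevelThreeNormalForm`
(given the engine `DilationMove`, item 3872). -/
theorem reductionTwoSix_of_parityDescent' (hD : DilationMove) (h0 : ParitySplit)
    (h2 : LevelThreeNormalForm) : ReductionTwoSix :=
  reductionTwoSix_of_parityDescent h0 (parityDescent_of_dilationMove hD) h2 normalFormAdd_holds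

/-- Card B therefore needs exactly two stubs (algebraic half + analytic half). -/
theorem reductionTwoSix_of_presentation' (hA : PolynomialNormalFormSix) (hC : NumeratorCongruence) :
    ReductionTwoSix :=
  reductionTwoSix_of_presentation hA hC sectorRepExists_holds

/-- **No division needed, for the record**: any box equivalence transports along `f ↦ q•f`
(tree: `KZ.Equivalent.constMul`, the scaling endomorphism of the calculus), so `ker Ψ` is a
ℚ-subspace of `ℚ[X]` and the route's "no division rule" worry does not arise on a frozen domain. -/
example (q : ℚ) {r r' : KZ.IntegralRep 2} (h : KZ.Equivalent r r') :
    KZ.Equivalent (r.constMul (q : ℝ) (isAlgebraic_algebraMap q))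
      (r'.constMul (q : ℝ) (isAlgebraic_algebraMap q)) :=
  KZ.Equivalent.constMul (q : ℝ) (isAlgebraic_algebraMap q) h

end

end Summit.KontsevichZagierPeriods.KontsevichZagierPeriods.Cruxes.ReductionTwoSix.Sketch
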